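import Literature.Analysis.FluidPDE.ForcedFourierForceData
import Literature.Analysis.FluidPDE.TaoH1FourierDecompositionProofs
import Literature.Analysis.FluidPDE.TaoH1FourierMild
import Literature.Analysis.FluidPDE.TaoLocalisation
import HarnessLib

/-!
# Plancherel bookkeeping for the Fourier-side force: the `H¹` quantity of the force slices and
# the `ℓ²`-contraction of the Leray part

Glue file of the FORCED twin of the weighted-`L²` Fourier-side construction of Tao's local smooth
solution (T. Tao, *Localisation and compactness properties of the Navier–Stokes global regularity
problem*, Anal. PDE 6 (2013) 25–107 = arXiv:1108.1165, Thm. 5.4 = arXiv Thm. 31, p. 18, stated and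
proved WITH a forcing term `f`). The three halves of that twin are the EXISTENCE half (the forced
Duhamel map `FourierNS.duhamelForced`, `ForcedFourierDuhamelDefs` / `…Forcing` / `ForcedFourierPicard*`),
the CLASSICAL half (`ForcedFourierMildFamily` / `…Solution` / `…Classical`) and the PHYSICAL TRANSFER
of the force (`ForcedFourierForceData`: the Fourier-side force
`forceData hT hf hd t ξ l = 𝓕⁻ (f (clamp T t))ₗ^ℂ (ξ)` of a force `f` that is jointly smooth on the
slab `[0, T] × ℝ^ι` with Tao's Schwartz bounds there). The named fact to be discharged,
`tao2011_smooth_local_existence_forced` (`TaoH1LocalExistenceForced.lean`), states its smallness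
hypothesis on the PHYSICAL side,

  `∀ t ∈ [0, T], ∫ ‖f t‖² + ∫ |∇ₓ f t|²_F ≤ B²`,   `(A + B T)⁴ T ≤ c ν³`,

while the existence half measures the force on the FOURIER side, and the velocity equation carries
the Leray-PROJECTED force `ξ ↦ lerayPart (forceData … t) ξ` (`FourierNS.lerayPart`,
`TaoH1FourierMild.lean`). This file supplies the two identities/inequalities that translate one
currency into the other:

* `lintegral_h1Weight_sum_enorm_sq_eq_of_fourier_eq` — **Plancherel with one derivative
  (Stein–Weiss 1971, Ch. I, Thm. 2.3 with Thm. 1.8)**: if `u : ℝ^ι → ℝ^ι` is smooth with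
  `∫ ‖Dⁿu‖² < ∞` for all `n` and `b : ℝ^ι → ℂ^ι` has integrable square-integrable components with
  `𝓕 bₗ = uₗ^ℂ`, then `∫ (1 + 4π²‖ξ‖²) ∑ₗ |bₗ(ξ)|² dξ = ∫ ‖u‖² + ∫ |∇u|²_F` (the tree's `L²`-level
  identity `lintegral_weight_mul_enorm_sq_fourierInv_eq` for the representative `𝓕⁻¹uₗ`, identified
  with `bₗ` a.e. by the injectivity of `𝓕` on `L¹ ∩ L²`, `ae_eq_of_fourierIntegral_eq`); its
  specialisations `lintegral_h1Weight_sum_enorm_sq_fourierData` (Schwartz fields) and, on `ℝ³`,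
  **`fourierH1Sq_forceData`**: `fourierH1Sq (forceData hT hf hd t) = ∫ ‖f (clamp T t)‖² + ∫ |∇ f (clamp T t)|²_F`
  for every `t`, so that the physical hypothesis above reads `fourierH1Sq (forceData … t) ≤ B²` for
  ALL real `t` (`fourierH1Sq_forceData_le_of_forall_mem`);
* `sum_norm_sq_lerayPart_le` — **the Leray part is an `ℓ²`-contraction at every frequency**:
  `∑ₗ |(P(ξ)z)ₗ|² = ∑ₗ |zₗ|² − |ξ·z|²/‖ξ‖² ≤ ∑ₗ |zₗ|²` (`P(ξ) = 1 − ξ ⊗ ξ/‖ξ‖²` is a real orthogonal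
  projection acting on real and imaginary parts), with the `ℝ≥0∞` form, the majorant form
  `(∑ₗ |(P(ξ)z)ₗ|)² ≤ card ι · ∑ₗ |zₗ|²`, and `fourierH1Sq (lerayPart z) ≤ fourierH1Sq z`; hence
  `fourierH1Sq (lerayPart (forceData … t)) ≤ B²`;
* `lintegral_weight_sum_enorm_sq_le_of_hasDecay` — every weighted square moment of a coefficient
  field with pointwise decay is finite, with the explicit bound
  `∫ (1+‖ξ‖)^{2k} ∑ₗ |bₗ|² ≤ card ι · C² · I_{2K₀}` from `HasDecay (k + K₀) C b`, `2K₀ > card ι`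
  (applies to every slice of `forceData` and of its Leray part, uniformly in time, by
  `hasDecay_forceData_uniform`).

All statements are theorems (no definitions, no named facts). On the physical side this is the
line "`‖f‖_{L¹_t H¹_x} ≤ T sup_t ‖f(t)‖_{H¹_x}`, `‖P f‖_{H¹} ≤ ‖f‖_{H¹}`" of the energy estimate in
the proof of Tao's Thm. 5.1/5.4 (arXiv p. 16: (energy-duh2) of Lemma 2.1 = arXiv Lemma 23, p. 10,
applied to `F = P f − P∇·(u ⊗ u)`).

## Mathlib / tree search

Tree (reused): `FourierNS.forceData`, `fourier_forceData`, `hasDecay_forceData_uniform`,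
`continuous_forceData_slice`, `contDiff_slice_clamp`, `hasRapidSpatialDecay_slice_clamp`
(`ForcedFourierForceData`); `fourierData`, `fourier_fourierData`, `hasDecay_fourierData`,
`continuous_fourierData` (`NSFourierData`); `lintegral_weight_mul_enorm_sq_fourierInv_eq`,
`lintegral_enorm_sq_fourierInv_of_ae_eq`, `fourierIntegral_fourierInv_eq`, `integrable_fourierInv`,
`ae_eq_of_fourierIntegral_eq`, `memLp_ipderiv_apply`, `enorm_sq_eq_sum_enorm_ofReal_sq`,
`ofReal_frobeniusNormSq_fderiv_eq_sum` (`TaoH1FourierDecompositionProofs`); `fourierH1Sq`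
(`TaoH1FourierDecomposition`); `lerayPart`, `sum_ofReal_mul_self` (`TaoH1FourierMild`);
`HasDecay.integrable`, `memLp_two_of_hasDecay`, `integrable_inv_one_add_norm_pow`
(`NSFourierBilinear`, `NSLocalRegular`, `NSFourierPicard`);
`HasRapidSpatialDecay.lintegral_enorm_iteratedFDeriv_sq_lt_top` (`TaoLocalisation`). Mathlib:
`Finset.sum_mul_sq_le_sq_mul_sq`, `Complex.normSq`, `MemLp.toLp`. `lean search 'fourierH1Sq'`:
no identity for `forceData`/`fourierData` slices existed; `lean search 'lerayPart'`: only the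
divergence/symmetry lemmas of `TaoH1FourierMild`.

## References

* T. Tao, Anal. PDE 6 (2013) 25–107 = arXiv:1108.1165: (7) p. 3, Lemma 2.1 = arXiv Lemma 23
  p. 10, Thm. 5.4 = arXiv Thm. 31 p. 18 with the proof of Thm. 5.1 = arXiv Thm. 28 p. 16. [Tao2011]
* E. M. Stein, G. Weiss, *Introduction to Fourier analysis on Euclidean spaces*, Princeton 1971,
  Ch. I, Thm. 1.8 and Thm. 2.3. [SteinWeiss1971]
-/

noncomputable section

open MeasureTheory Set Function Filter Real Complex FourierTransform
open scoped FourierTransform RealInnerProductSpace ENNReal NNReal ContDiff ComplexConjugate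
open _root_.Topology

namespace Literature.Analysis.FluidPDE.FourierNS

/-! ### The Leray part is an `ℓ²`-contraction -/

section LerayPart

variable {ι : Type*} [Fintype ι]

/-- **The Leray part is an `ℓ²`-contraction at every frequency** (Stein–Weiss / Lemarié-Rieusset:
`P(ξ) = 1 − ξ ⊗ ξ/‖ξ‖²` is an orthogonal projection): `∑ₗ |(P(ξ)z)ₗ|² ≤ ∑ₗ |zₗ|²`, indeed
`∑ₗ |(P(ξ)z)ₗ|² = ∑ₗ |zₗ|² − |ξ·z|²/‖ξ‖²` for `ξ ≠ 0` (and `P(0) = 1` in the tree's `x/0 = 0`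
convention). [cite: Tao2011, Thm. 5.4 proof (arXiv Thm. 31, p. 18; energy estimate (energy-duh2) p. 10 for `F = P f`)] -/
theorem sum_norm_sq_lerayPart_le (z : EuclideanSpace ℝ ι → ι → ℂ) (ξ : EuclideanSpace ℝ ι) :
    ∑ l, ‖lerayPart z ξ l‖ ^ 2 ≤ ∑ l, ‖z ξ l‖ ^ 2 := by
  by_cases hξ : ξ = 0
  · subst hξ
    refine Finset.sum_le_sum fun l _ => ?_
    simp [lerayPart]
  set s : ℂ := ∑ k, ((ξ k : ℝ) : ℂ) * z ξ k with hs
  set n2 : ℝ := ‖ξ‖ ^ 2 with hn2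
  have hn2pos : 0 < n2 := by positivity
  have hn2C : ((n2 : ℝ) : ℂ) ≠ 0 := by exact_mod_cast hn2pos.ne'
  -- `∑ |P z|² = ∑ |z|² − |s|²/‖ξ‖²`, computed with `Complex.normSq` written as `w * conj w`
  have hterm : ∀ l, (‖lerayPart z ξ l‖ ^ 2 : ℝ) =
      ‖z ξ l‖ ^ 2 - 2 * (ξ l) * ((z ξ l * conj s).re / n2) + (ξ l) ^ 2 * (‖s‖ ^ 2 / n2 ^ 2) := by
    intro l
    have h1 : lerayPart z ξ l = z ξ l - ((ξ l : ℝ) : ℂ) * s / ((n2 : ℝ) : ℂ) := rfl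
    have h2 : (z ξ l * conj (((ξ l : ℝ) : ℂ) * s / ((n2 : ℝ) : ℂ))).re =
        (ξ l) * ((z ξ l * conj s).re / n2) := by
      rw [map_div₀, map_mul, Complex.conj_ofReal, Complex.conj_ofReal, ← mul_div_assoc,
        Complex.div_ofReal_re]
      have : z ξ l * (((ξ l : ℝ) : ℂ) * conj s) = ((ξ l : ℝ) : ℂ) * (z ξ l * conj s) := by ring
      rw [this, Complex.re_ofReal_mul]
      ring
    rw [h1, ← Complex.normSq_eq_norm_sq, ← Complex.normSq_eq_norm_sq, Complex.normSq_sub,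
      Complex.normSq_div, Complex.normSq_mul, Complex.normSq_ofReal, Complex.normSq_ofReal, h2]
    simp only [Complex.normSq_eq_norm_sq]
    field_simp
    ring
  have hsum_sq : ∑ l, (ξ l) ^ 2 = n2 := by
    rw [hn2, EuclideanSpace.real_norm_sq_eq]
  have hsum_re : ∑ l, (ξ l) * ((z ξ l * conj s).re / n2) = ‖s‖ ^ 2 / n2 := by
    have h1 : ∑ l, (ξ l) * ((z ξ l * conj s).re / n2) = (∑ l, (ξ l) * (z ξ l * conj s).re) / n2 := by
      rw [Finset.sum_div]
      exact Finset.sum_congr rfl fun l _ => by ring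
    have h2 : ∑ l, (ξ l) * (z ξ l * conj s).re = (s * conj s).re := by
      rw [hs, Finset.sum_mul, Complex.re_sum]
      refine Finset.sum_congr rfl fun l _ => ?_
      rw [← hs, mul_assoc, Complex.re_ofReal_mul]
    rw [h1, h2, Complex.mul_conj, Complex.normSq_eq_norm_sq, Complex.ofReal_re]
  calc ∑ l, ‖lerayPart z ξ l‖ ^ 2
      = ∑ l, (‖z ξ l‖ ^ 2 - 2 * (ξ l) * ((z ξ l * conj s).re / n2) +
          (ξ l) ^ 2 * (‖s‖ ^ 2 / n2 ^ 2)) := Finset.sum_congr rfl fun l _ => hterm l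
    _ = ∑ l, ‖z ξ l‖ ^ 2 - 2 * ∑ l, (ξ l) * ((z ξ l * conj s).re / n2) +
          (∑ l, (ξ l) ^ 2) * (‖s‖ ^ 2 / n2 ^ 2) := by
        rw [Finset.sum_add_distrib, Finset.sum_sub_distrib, Finset.mul_sum, Finset.sum_mul]
        refine congrArg₂ _ (congrArg₂ _ rfl (Finset.sum_congr rfl fun l _ => by ring)) rfl
    _ = ∑ l, ‖z ξ l‖ ^ 2 - ‖s‖ ^ 2 / n2 := by
        rw [hsum_re, hsum_sq]
        field_simp
        ring
    _ ≤ ∑ l, ‖z ξ l‖ ^ 2 := sub_le_self _ (by positivity)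

/-- `ℝ≥0∞` form of `sum_norm_sq_lerayPart_le`: `∑ₗ ‖(P(ξ)z)ₗ‖ₑ² ≤ ∑ₗ ‖zₗ‖ₑ²`. [cite: Tao2011, Thm. 5.4 proof (arXiv Thm. 31, p. 18)] -/
theorem sum_enorm_sq_lerayPart_le (z : EuclideanSpace ℝ ι → ι → ℂ) (ξ : EuclideanSpace ℝ ι) :
    ∑ l, ‖lerayPart z ξ l‖ₑ ^ 2 ≤ ∑ l, ‖z ξ l‖ₑ ^ 2 := by
  have h : ∀ w : ℂ, ‖w‖ₑ ^ 2 = ENNReal.ofReal (‖w‖ ^ 2) := fun w => by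
    rw [← ofReal_norm, ENNReal.ofReal_pow (norm_nonneg _)]
  simp_rw [h]
  rw [← ENNReal.ofReal_sum_of_nonneg fun l _ => sq_nonneg _,
    ← ENNReal.ofReal_sum_of_nonneg fun l _ => sq_nonneg _]
  exact ENNReal.ofReal_le_ofReal (sum_norm_sq_lerayPart_le z ξ)

/-- **Majorant form**: `(∑ₗ |(P(ξ)z)ₗ|)² ≤ card ι · ∑ₗ |zₗ|²` (Cauchy–Schwarz on the finite sum and
the `ℓ²`-contraction) — the currency `M_b = ∑ₗ ‖bₗ‖ₑ` of the forced Picard bounds. [cite: Tao2011, Thm. 5.4 proof (arXiv Thm. 31, p. 18)] -/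
theorem sq_sum_norm_lerayPart_le (z : EuclideanSpace ℝ ι → ι → ℂ) (ξ : EuclideanSpace ℝ ι) :
    (∑ l, ‖lerayPart z ξ l‖) ^ 2 ≤ Fintype.card ι * ∑ l, ‖z ξ l‖ ^ 2 := by
  have hcs : (∑ l, ‖lerayPart z ξ l‖) ^ 2 ≤ Fintype.card ι * ∑ l, ‖lerayPart z ξ l‖ ^ 2 := by
    have h := Finset.sum_mul_sq_le_sq_mul_sq Finset.univ (fun _ : ι => (1 : ℝ))
      (fun l => ‖lerayPart z ξ l‖)
    simpa only [one_mul, one_pow, Finset.sum_const, Finset.card_univ, nsmul_eq_mul, mul_one]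
      using h
  exact hcs.trans (mul_le_mul_of_nonneg_left (sum_norm_sq_lerayPart_le z ξ) (by positivity))

/-- Measurability of the Leray part of a measurable coefficient field (the Leray projection
`P(ξ) = 1 − ξ ⊗ ξ/‖ξ‖²` is a Borel function of the frequency). [cite: Tao2011, (7)–(9) p. 3 (Leray projection `P`) and Thm. 5.4 proof (arXiv Thm. 31, p. 18)] -/
theorem measurable_lerayPart {z : EuclideanSpace ℝ ι → ι → ℂ} (hz : Measurable z) :
    Measurable (lerayPart z) := by
  refine measurable_pi_iff.2 fun l => ?_
  have hzl : ∀ k, Measurable fun ξ => z ξ k := fun k => (measurable_pi_apply k).comp hz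
  have hc : ∀ k, Measurable fun ξ : EuclideanSpace ℝ ι => ((ξ k : ℝ) : ℂ) := fun k =>
    (by fun_prop : Continuous fun ξ : EuclideanSpace ℝ ι => ((ξ k : ℝ) : ℂ)).measurable
  have hsum : Measurable fun ξ : EuclideanSpace ℝ ι => ∑ k, ((ξ k : ℝ) : ℂ) * z ξ k :=
    Finset.measurable_sum _ fun k _ => (hc k).mul (hzl k)
  have hnorm : Measurable fun ξ : EuclideanSpace ℝ ι => ((‖ξ‖ ^ 2 : ℝ) : ℂ) :=
    Complex.measurable_ofReal.comp (measurable_norm.pow_const 2)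
  exact (hzl l).sub (((hc l).mul hsum).div hnorm)

/-- **`fourierH1Sq (P z) ≤ fourierH1Sq z`**: the Fourier-side `H¹` quantity does not increase
under the Leray projection (`‖P f‖_{H¹} ≤ ‖f‖_{H¹}`). [cite: Tao2011, Thm. 5.4 proof (arXiv Thm. 31, p. 18)] -/
theorem fourierH1Sq_lerayPart_le (z : EuclideanSpace ℝ (Fin 3) → Fin 3 → ℂ) :
    fourierH1Sq (lerayPart z) ≤ fourierH1Sq z := by
  unfold fourierH1Sq
  exact lintegral_mono fun ξ => mul_le_mul' le_rfl (sum_enorm_sq_lerayPart_le z ξ)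

end LerayPart

/-! ### Weighted square moments of a field with pointwise decay -/

section Moments

variable {ι : Type*} [Fintype ι]

/-- **Every weighted square moment of a coefficient field with pointwise decay is finite**, with
the bound `∫ (1+‖ξ‖)^{2k} ∑ₗ |bₗ(ξ)|² dξ ≤ card ι · C² · I_{2K₀}` from `HasDecay (k + K₀) C b` and
`2K₀ > card ι` (`I_m = ∫ (1+‖ξ‖)^{-m}`, the tree's `weightMass`) — the weighted-`L²` (Sobolev)
class of a Schwartz function on the Fourier side. [cite: SteinWeiss1971, Ch. I Thm. 2.3 + Thm. 1.8] -/
theorem lintegral_weight_sum_enorm_sq_le_of_hasDecay {b : EuclideanSpace ℝ ι → ι → ℂ} {k K₀ : ℕ}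
    {C : ℝ} (hb : HasDecay (k + K₀) C b) (hK₀ : Fintype.card ι < 2 * K₀) :
    ∫⁻ ξ, ENNReal.ofReal ((1 + ‖ξ‖) ^ (2 * k)) * ∑ l, ‖b ξ l‖ₑ ^ 2 ≤
      ENNReal.ofReal (Fintype.card ι * C ^ 2 * weightMass (EuclideanSpace ℝ ι) (2 * K₀)) := by
  have hC : 0 ≤ C := hb.nonneg
  have hI := integrable_inv_one_add_norm_pow (E := EuclideanSpace ℝ ι) (K := 2 * K₀)
    (by rw [finrank_euclideanSpace]; exact hK₀)
  -- pointwise bound of the integrand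
  have hpt : ∀ ξ : EuclideanSpace ℝ ι, ENNReal.ofReal ((1 + ‖ξ‖) ^ (2 * k)) * ∑ l, ‖b ξ l‖ₑ ^ 2 ≤
      ENNReal.ofReal (Fintype.card ι * C ^ 2 * ((1 + ‖ξ‖) ^ (2 * K₀))⁻¹) := by
    intro ξ
    have hw : 0 < (1 + ‖ξ‖) := by positivity
    have hl : ∀ l, (1 + ‖ξ‖) ^ (2 * k) * ‖b ξ l‖ ^ 2 ≤ C ^ 2 * ((1 + ‖ξ‖) ^ (2 * K₀))⁻¹ := by
      intro l
      have h1 : ‖b ξ l‖ ≤ C * ((1 + ‖ξ‖) ^ (k + K₀))⁻¹ := (norm_le_pi_norm (b ξ) l).trans (hb ξ)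
      have h2 : (1 + ‖ξ‖) ^ k * ‖b ξ l‖ ≤ C * ((1 + ‖ξ‖) ^ K₀)⁻¹ := by
        have hk0 : 0 < (1 + ‖ξ‖) ^ K₀ := by positivity
        rw [le_mul_inv_iff₀ hk0]
        calc (1 + ‖ξ‖) ^ k * ‖b ξ l‖ * (1 + ‖ξ‖) ^ K₀ = (1 + ‖ξ‖) ^ (k + K₀) * ‖b ξ l‖ := by
              rw [pow_add]; ring
          _ ≤ (1 + ‖ξ‖) ^ (k + K₀) * (C * ((1 + ‖ξ‖) ^ (k + K₀))⁻¹) :=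
              mul_le_mul_of_nonneg_left h1 (by positivity)
          _ = C := by field_simp
      have h3 := pow_le_pow_left₀ (by positivity) h2 2
      calc (1 + ‖ξ‖) ^ (2 * k) * ‖b ξ l‖ ^ 2 = ((1 + ‖ξ‖) ^ k * ‖b ξ l‖) ^ 2 := by
            rw [mul_pow, ← pow_mul, mul_comm k 2]
        _ ≤ (C * ((1 + ‖ξ‖) ^ K₀)⁻¹) ^ 2 := h3
        _ = C ^ 2 * ((1 + ‖ξ‖) ^ (2 * K₀))⁻¹ := by
            rw [mul_pow, inv_pow, ← pow_mul, mul_comm K₀ 2]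
    have hsum : (1 + ‖ξ‖) ^ (2 * k) * ∑ l, ‖b ξ l‖ ^ 2 ≤
        Fintype.card ι * C ^ 2 * ((1 + ‖ξ‖) ^ (2 * K₀))⁻¹ := by
      rw [Finset.mul_sum]
      calc ∑ l, (1 + ‖ξ‖) ^ (2 * k) * ‖b ξ l‖ ^ 2 ≤ ∑ _l : ι, C ^ 2 * ((1 + ‖ξ‖) ^ (2 * K₀))⁻¹ :=
            Finset.sum_le_sum fun l _ => hl l
        _ = Fintype.card ι * C ^ 2 * ((1 + ‖ξ‖) ^ (2 * K₀))⁻¹ := by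
            rw [Finset.sum_const, Finset.card_univ, nsmul_eq_mul]; ring
    have henorm : ∀ w : ℂ, ‖w‖ₑ ^ 2 = ENNReal.ofReal (‖w‖ ^ 2) := fun w => by
      rw [← ofReal_norm, ENNReal.ofReal_pow (norm_nonneg _)]
    simp_rw [henorm]
    rw [← ENNReal.ofReal_sum_of_nonneg fun l _ => sq_nonneg _, ← ENNReal.ofReal_mul (by positivity)]
    exact ENNReal.ofReal_le_ofReal hsum
  calc ∫⁻ ξ, ENNReal.ofReal ((1 + ‖ξ‖) ^ (2 * k)) * ∑ l, ‖b ξ l‖ₑ ^ 2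
      ≤ ∫⁻ ξ, ENNReal.ofReal (Fintype.card ι * C ^ 2 * ((1 + ‖ξ‖) ^ (2 * K₀))⁻¹) :=
        lintegral_mono hpt
    _ = ENNReal.ofReal (∫ ξ, Fintype.card ι * C ^ 2 * ((1 + ‖ξ‖) ^ (2 * K₀))⁻¹) := by
        rw [ofReal_integral_eq_lintegral_ofReal (hI.const_mul _)
          (Eventually.of_forall fun ξ => by positivity)]
    _ = ENNReal.ofReal (Fintype.card ι * C ^ 2 * weightMass (EuclideanSpace ℝ ι) (2 * K₀)) := by
        rw [integral_const_mul, weightMass]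

/-- Finite weighted square moments of every order from pointwise decay of every order (Schwartz
⊂ `H^k` for all `k`, on the Fourier side). [cite: SteinWeiss1971, Ch. I Thm. 2.3 + Thm. 1.8] -/
theorem lintegral_weight_sum_enorm_sq_lt_top_of_hasDecay {b : EuclideanSpace ℝ ι → ι → ℂ}
    (hb : ∀ K : ℕ, ∃ C, HasDecay K C b) (k : ℕ) :
    ∫⁻ ξ, ENNReal.ofReal ((1 + ‖ξ‖) ^ (2 * k)) * ∑ l, ‖b ξ l‖ₑ ^ 2 < ⊤ := by
  obtain ⟨C, hC⟩ := hb (k + (Fintype.card ι + 1))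
  exact lt_of_le_of_lt (lintegral_weight_sum_enorm_sq_le_of_hasDecay hC (by omega))
    ENNReal.ofReal_lt_top

end Moments

/-! ### Plancherel with one derivative for a coefficient field with prescribed synthesis -/

section Plancherel

variable {ι : Type*} [Fintype ι] [DecidableEq ι]

/-- **Plancherel with one derivative (Stein–Weiss 1971, Ch. I, Thm. 2.3 with Thm. 1.8).** Let
`u : ℝ^ι → ℝ^ι` be smooth with `∫ ‖Dⁿu‖² < ∞` for every `n`, and let `b : ℝ^ι → ℂ^ι` have integrable,
square-integrable components with `𝓕 bₗ = uₗ^ℂ` for every `l`. Then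
`∫ (1 + 4π²‖ξ‖²) ∑ₗ |bₗ(ξ)|² dξ = ∫ ‖u‖² + ∫ |∇u|²_F` (Frobenius norm of the gradient). Proof: `bₗ`
agrees a.e. with the `L²` representative `𝓕⁻¹uₗ` (both are in `L¹ ∩ L²` with the same Fourier
integral, `ae_eq_of_fourierIntegral_eq`), for which the identity is the tree's
`lintegral_weight_mul_enorm_sq_fourierInv_eq` (orders `0` and `1`) summed over the components.
[cite: SteinWeiss1971, Ch. I Thm. 2.3 + Thm. 1.8] -/
theorem lintegral_h1Weight_sum_enorm_sq_eq_of_fourier_eq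
    {u : EuclideanSpace ℝ ι → EuclideanSpace ℝ ι} (hsm : ContDiff ℝ ∞ u)
    (hH : ∀ n : ℕ, ∫⁻ x, ‖iteratedFDeriv ℝ n u x‖ₑ ^ 2 < ⊤)
    {b : EuclideanSpace ℝ ι → ι → ℂ} (hb1 : ∀ l, Integrable fun ξ => b ξ l)
    (hb2 : ∀ l, MemLp (fun ξ => b ξ l) 2 volume)
    (hF : ∀ l, 𝓕 (fun ξ => b ξ l) = fun x => ((u x l : ℝ) : ℂ)) :
    ∫⁻ ξ, ENNReal.ofReal (1 + 4 * π ^ 2 * ‖ξ‖ ^ 2) * ∑ l, ‖b ξ l‖ₑ ^ 2 =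
      (∫⁻ x, ‖u x‖ₑ ^ 2) + ∫⁻ x, ENNReal.ofReal (frobeniusNormSq (fderiv ℝ u x)) := by
  -- the components, their `L²` classes and their `L²` inverse transforms
  set g : ι → (EuclideanSpace ℝ ι) → ℝ := fun l y => u y l with hg_def
  have hg : ∀ l, ContDiff ℝ ∞ (g l) := fun l => contDiff_euclidean.1 hsm l
  have hL2 : ∀ l {m : ℕ} (β : Fin m → ι), MemLp (fun x => ((ipderiv β (g l) x : ℝ) : ℂ)) 2 volume :=
    fun l m β => memLp_ipderiv_apply hsm hH l β
  set X₀ : ι → Lp ℂ 2 (volume : Measure (EuclideanSpace ℝ ι)) :=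
    fun l => (hL2 l (Fin.elim0 : Fin 0 → ι)).toLp _ with hX₀_def
  have hX₀ : ∀ l, (X₀ l : EuclideanSpace ℝ ι → ℂ) =ᵐ[volume] fun x => ((g l x : ℝ) : ℂ) :=
    fun l => MemLp.coeFn_toLp _
  set F : ι → EuclideanSpace ℝ ι → ℂ :=
    fun l => ((𝓕⁻ (X₀ l) : Lp ℂ 2 volume) : EuclideanSpace ℝ ι → ℂ) with hF_def
  have hFm : ∀ l, AEStronglyMeasurable (F l) volume := fun l => Lp.aestronglyMeasurable _
  -- `bₗ = Fₗ` almost everywhere: same Fourier integral, both in `L¹ ∩ L²`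
  have hbF : ∀ l, (fun ξ => b ξ l) =ᵐ[volume] F l := by
    intro l
    refine ae_eq_of_fourierIntegral_eq (hb1 l) (hb2 l) (integrable_fourierInv (hg l) (hL2 l) (hX₀ l))
      (Lp.memLp _) ?_
    rw [hF l, hF_def, fourierIntegral_fourierInv_eq (hg l) (hL2 l) (hX₀ l)]
  have hall : ∀ᵐ ξ, ∀ l, b ξ l = F l ξ := ae_all_iff.2 fun l => hbF l
  -- the `H¹` identity
  have h4π : ∀ ξ : EuclideanSpace ℝ ι, ENNReal.ofReal (1 + 4 * π ^ 2 * ‖ξ‖ ^ 2) =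
      1 + ENNReal.ofReal ((2 * π) ^ (2 * 1) * ‖ξ‖ ^ (2 * 1)) := fun ξ => by
    rw [ENNReal.ofReal_add zero_le_one (by positivity), ENNReal.ofReal_one]
    congr 2
    ring
  calc ∫⁻ ξ, ENNReal.ofReal (1 + 4 * π ^ 2 * ‖ξ‖ ^ 2) * ∑ l, ‖b ξ l‖ₑ ^ 2
      = ∫⁻ ξ, ∑ l, (‖F l ξ‖ₑ ^ 2 +
          ENNReal.ofReal ((2 * π) ^ (2 * 1) * ‖ξ‖ ^ (2 * 1)) * ‖F l ξ‖ₑ ^ 2) := by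
        refine lintegral_congr_ae ?_
        filter_upwards [hall] with ξ hξ
        rw [h4π, Finset.mul_sum]
        exact Finset.sum_congr rfl fun l _ => by rw [hξ l, add_mul, one_mul]
    _ = ∑ l, ((∫⁻ ξ, ‖F l ξ‖ₑ ^ 2) +
          ∫⁻ ξ, ENNReal.ofReal ((2 * π) ^ (2 * 1) * ‖ξ‖ ^ (2 * 1)) * ‖F l ξ‖ₑ ^ 2) := by
        rw [lintegral_finsetSum' _ fun l _ => ?_]
        · exact Finset.sum_congr rfl fun l _ =>
            lintegral_add_left' ((hFm l).aemeasurable.enorm.pow_const _) _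
        · exact (((hFm l).aemeasurable.enorm.pow_const _).add ((ENNReal.measurable_ofReal.comp
            (by fun_prop)).aemeasurable.mul ((hFm l).aemeasurable.enorm.pow_const _)))
    _ = ∑ l, ((∫⁻ x, ‖((g l x : ℝ) : ℂ)‖ₑ ^ 2) +
          ∑ α : Fin 1 → ι, ∫⁻ x, ‖((ipderiv α (g l) x : ℝ) : ℂ)‖ₑ ^ 2) := by
        refine Finset.sum_congr rfl fun l _ => ?_
        rw [hF_def, lintegral_enorm_sq_fourierInv_of_ae_eq (hX₀ l),
          lintegral_weight_mul_enorm_sq_fourierInv_eq (hg l) (hL2 l) (hX₀ l) 1]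
    _ = (∑ l, ∫⁻ x, ‖((g l x : ℝ) : ℂ)‖ₑ ^ 2) +
          ∑ l, ∑ α : Fin 1 → ι, ∫⁻ x, ‖((ipderiv α (g l) x : ℝ) : ℂ)‖ₑ ^ 2 :=
        Finset.sum_add_distrib
    _ = (∫⁻ x, ‖u x‖ₑ ^ 2) + ∫⁻ x, ENNReal.ofReal (frobeniusNormSq (fderiv ℝ u x)) := by
        congr 1
        · rw [← lintegral_finsetSum _ fun l _ => ?_]
          · exact lintegral_congr fun x => (enorm_sq_eq_sum_enorm_ofReal_sq (u x)).symm
          · exact (Complex.continuous_ofReal.comp (hg l).continuous).measurable.enorm.pow_const _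
        · have hmeas : ∀ l (α : Fin 1 → ι),
              Measurable fun x => ‖((ipderiv α (g l) x : ℝ) : ℂ)‖ₑ ^ 2 := fun l α =>
            (Complex.continuous_ofReal.comp
              (contDiff_ipderiv (hg l) α).continuous).measurable.enorm.pow_const _
          rw [← Finset.sum_congr rfl fun l _ => lintegral_finsetSum _ fun α _ => hmeas l α,
            ← lintegral_finsetSum _ fun l _ => Finset.measurable_sum _ fun α _ => hmeas l α]
          exact lintegral_congr fun x =>
            (ofReal_frobeniusNormSq_fderiv_eq_sum ((hsm.differentiable (by simp)) x)).symm

/-- **Plancherel with one derivative for a Schwartz field**: for `u` smooth and rapidly decaying,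
`∫ (1 + 4π²‖ξ‖²) ∑ₗ |(fourierData u)ₗ(ξ)|² dξ = ∫ ‖u‖² + ∫ |∇u|²_F`. [cite: SteinWeiss1971, Ch. I Thm. 2.3 + Thm. 1.8] -/
theorem lintegral_h1Weight_sum_enorm_sq_fourierData
    {u : EuclideanSpace ℝ ι → EuclideanSpace ℝ ι} (hu : ContDiff ℝ ∞ u)
    (hdec : HasRapidSpatialDecay u) :
    ∫⁻ ξ, ENNReal.ofReal (1 + 4 * π ^ 2 * ‖ξ‖ ^ 2) * ∑ l, ‖fourierData hu hdec ξ l‖ₑ ^ 2 =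
      (∫⁻ x, ‖u x‖ₑ ^ 2) + ∫⁻ x, ENNReal.ofReal (frobeniusNormSq (fderiv ℝ u x)) := by
  obtain ⟨A, hA⟩ := hasDecay_fourierData hu hdec (Fintype.card ι + 1)
  have hm : ∀ l, AEStronglyMeasurable (fun ξ => fourierData hu hdec ξ l) volume := fun l =>
    ((continuous_apply l).comp (continuous_fourierData hu hdec)).aestronglyMeasurable
  have hAl : ∀ l, HasDecay (Fintype.card ι + 1) A (fun ξ => fourierData hu hdec ξ l) :=
    fun l => hA.apply l
  exact lintegral_h1Weight_sum_enorm_sq_eq_of_fourier_eq hu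
    (hdec.lintegral_enorm_iteratedFDeriv_sq_lt_top)
    (fun l => (hAl l).integrable (finrank_lt_of_card_lt (Nat.lt_succ_self _)) (hm l))
    (fun l => memLp_two_of_hasDecay (Nat.lt_succ_self _) (hAl l) (hm l))
    (fourier_fourierData hu hdec)

end Plancherel

/-! ### The force: `H¹` quantity of the slices, projected slices, moments -/

section Force

variable {ι : Type*} [Fintype ι] [DecidableEq ι]
variable {T : ℝ} {f : ℝ → EuclideanSpace ℝ ι → EuclideanSpace ℝ ι}
variable (hT : 0 < T) (hf : IsSmoothSpaceTimeOn (Icc 0 T) f) (hd : HasUniformRapidDecayOn (Icc 0 T) f)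

/-- **Plancherel with one derivative for the force slices (general dimension)**:
`∫ (1 + 4π²‖ξ‖²) ∑ₗ |(forceData … t)ₗ(ξ)|² dξ = ∫ ‖f (clamp T t)‖² + ∫ |∇f (clamp T t)|²_F` for every
real `t`. [cite: SteinWeiss1971, Ch. I Thm. 2.3 + Thm. 1.8] -/
theorem lintegral_h1Weight_sum_enorm_sq_forceData (t : ℝ) :
    ∫⁻ ξ, ENNReal.ofReal (1 + 4 * π ^ 2 * ‖ξ‖ ^ 2) * ∑ l, ‖forceData hT hf hd t ξ l‖ₑ ^ 2 =
      (∫⁻ x, ‖f (clamp T t) x‖ₑ ^ 2) +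
        ∫⁻ x, ENNReal.ofReal (frobeniusNormSq (fderiv ℝ (f (clamp T t)) x)) :=
  lintegral_h1Weight_sum_enorm_sq_fourierData (contDiff_slice_clamp hT hf t)
    (hasRapidSpatialDecay_slice_clamp hT hf hd t)

omit [DecidableEq ι] in
/-- **Finite weighted square moments of the force slices, uniformly in time**: for every `k` there
is `M < ∞` with `∫ (1+‖ξ‖)^{2k} ∑ₗ |(forceData … t)ₗ|² ≤ M` for all real `t`. [cite: Tao2011, Def. 1.1 (p. 3) and Thm. 5.4 proof (arXiv Thm. 31, p. 18)] -/
theorem exists_lintegral_weight_sum_enorm_sq_forceData_le (k : ℕ) :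
    ∃ M : ℝ≥0∞, M < ⊤ ∧ ∀ t : ℝ,
      ∫⁻ ξ, ENNReal.ofReal ((1 + ‖ξ‖) ^ (2 * k)) * ∑ l, ‖forceData hT hf hd t ξ l‖ₑ ^ 2 ≤ M := by
  obtain ⟨C, -, hC⟩ := hasDecay_forceData_uniform hT hf hd (k + (Fintype.card ι + 1))
  exact ⟨_, ENNReal.ofReal_lt_top, fun t =>
    lintegral_weight_sum_enorm_sq_le_of_hasDecay (hC t) (by omega)⟩

omit [DecidableEq ι] in
/-- The same for the Leray-projected force slices `lerayPart (forceData … t)`. [cite: Tao2011, Thm. 5.4 proof (arXiv Thm. 31, p. 18)] -/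
theorem exists_lintegral_weight_sum_enorm_sq_lerayPart_forceData_le (k : ℕ) :
    ∃ M : ℝ≥0∞, M < ⊤ ∧ ∀ t : ℝ,
      ∫⁻ ξ, ENNReal.ofReal ((1 + ‖ξ‖) ^ (2 * k)) *
        ∑ l, ‖lerayPart (forceData hT hf hd t) ξ l‖ₑ ^ 2 ≤ M := by
  obtain ⟨M, hM, hle⟩ := exists_lintegral_weight_sum_enorm_sq_forceData_le hT hf hd k
  refine ⟨M, hM, fun t => le_trans (lintegral_mono fun ξ => ?_) (hle t)⟩
  exact mul_le_mul' le_rfl (sum_enorm_sq_lerayPart_le _ ξ)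

variable {f : ℝ → EuclideanSpace ℝ (Fin 3) → EuclideanSpace ℝ (Fin 3)}
variable (hf : IsSmoothSpaceTimeOn (Icc 0 T) f) (hd : HasUniformRapidDecayOn (Icc 0 T) f)

/-- **The Fourier-side `H¹` quantity of a force slice is the physical one** (`ℝ³`):
`fourierH1Sq (forceData hT hf hd t) = ∫ ‖f (clamp T t)‖² + ∫ |∇ f (clamp T t)|²_F` for every real
`t`. [cite: SteinWeiss1971, Ch. I Thm. 2.3 + Thm. 1.8] -/
theorem fourierH1Sq_forceData (t : ℝ) :
    fourierH1Sq (forceData hT hf hd t) =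
      (∫⁻ x, ‖f (clamp T t) x‖ₑ ^ 2) +
        ∫⁻ x, ENNReal.ofReal (frobeniusNormSq (fderiv ℝ (f (clamp T t)) x)) := by
  rw [fourierH1Sq_eq]
  exact lintegral_h1Weight_sum_enorm_sq_forceData hT hf hd t

/-- On `[0, T]` the clamp disappears: `fourierH1Sq (forceData … t) = ∫ ‖f t‖² + ∫ |∇ f t|²_F`. [cite: SteinWeiss1971, Ch. I Thm. 2.3 + Thm. 1.8] -/
theorem fourierH1Sq_forceData_of_mem {t : ℝ} (ht : t ∈ Icc 0 T) :
    fourierH1Sq (forceData hT hf hd t) =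
      (∫⁻ x, ‖f t x‖ₑ ^ 2) + ∫⁻ x, ENNReal.ofReal (frobeniusNormSq (fderiv ℝ (f t) x)) := by
  rw [fourierH1Sq_forceData, clamp_of_mem ht]

/-- **The smallness currency of `tao2011_smooth_local_existence_forced` on the Fourier side**: if
`∫ ‖f t‖² + ∫ |∇f t|²_F ≤ B²` for all `t ∈ [0, T]` (the named fact's hypothesis on the force), then
`fourierH1Sq (forceData … t) ≤ B²` for EVERY real `t` (the Fourier-side force is clamped in time).
[cite: Tao2011, Thm. 5.4 (ii) (arXiv Thm. 31, p. 18)] -/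
theorem fourierH1Sq_forceData_le_of_forall_mem {B : ℝ}
    (hB : ∀ t ∈ Icc 0 T, (∫⁻ x, ‖f t x‖ₑ ^ 2) +
      (∫⁻ x, ENNReal.ofReal (frobeniusNormSq (fderiv ℝ (f t) x))) ≤ ENNReal.ofReal (B ^ 2))
    (t : ℝ) : fourierH1Sq (forceData hT hf hd t) ≤ ENNReal.ofReal (B ^ 2) := by
  rw [fourierH1Sq_forceData]
  exact hB (clamp T t) (clamp_mem_Icc hT.le t)

/-- The same bound for the Leray-projected force `lerayPart (forceData … t)` (the source of the
velocity equation): `fourierH1Sq (P b̂_f(t)) ≤ B²` for every real `t`. [cite: Tao2011, Thm. 5.4 (ii) (arXiv Thm. 31, p. 18)] -/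
theorem fourierH1Sq_lerayPart_forceData_le_of_forall_mem {B : ℝ}
    (hB : ∀ t ∈ Icc 0 T, (∫⁻ x, ‖f t x‖ₑ ^ 2) +
      (∫⁻ x, ENNReal.ofReal (frobeniusNormSq (fderiv ℝ (f t) x))) ≤ ENNReal.ofReal (B ^ 2))
    (t : ℝ) : fourierH1Sq (lerayPart (forceData hT hf hd t)) ≤ ENNReal.ofReal (B ^ 2) :=
  (fourierH1Sq_lerayPart_le _).trans (fourierH1Sq_forceData_le_of_forall_mem hT hf hd hB t)

end Force

end Literature.Analysis.FluidPDE.FourierNS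

end
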